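import Mathlib
import Literature.Analysis.ODE.RecessiveSolution

/-! # Helper A for the stub `stub_resolventExists` of the line `Sketch`
(crux stmt-AnomalousDissipation-3008, `MarginalStabilityChain.BurgersLayerKH`)

**Whole-line exponential dichotomy for `W'' = Q(t) W`, `re Q ≥ γ² > 0`, `Q : ℝ → ℂ` continuous.**
From the half-line theory of `Literature.Analysis.ODE.RecessiveSolution` (dichotomy energy
`E_γ = 2 re(W̄ W') + √2 γ ‖W‖²`) we build a pair of GLOBAL solutions `W₊` (recessive at `+∞`:
`E_γ(W₊) ≤ 0` on `ℝ`) and `W₋` (recessive at `−∞`, obtained by the reflection `t ↦ −t`), normalised to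
Wronskian `W₊ W₋' − W₊' W₋ ≡ 1`, with the two-sided decay
`‖W₊ t‖ ≤ e^{−(√2γ/2)(t−s)} ‖W₊ s‖`, `‖W₋ s‖ ≤ e^{−(√2γ/2)(t−s)} ‖W₋ t‖` (`s ≤ t`) and the KEY PRODUCT
BOUND `‖W₊ t‖ ‖W₋ t‖ ≤ 1/(√2 γ)` (from `re(W̄₊ W̄₋ · Wr) ≥ √2 γ ‖W₊‖² ‖W₋‖²`), which is what makes the
Green's function of `W'' − QW = g` bounded by `2‖g‖_∞/γ²` (helper B). Registered sub-goal:
`resolvent_dichotomy`.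
-/

set_option linter.dupNamespace false

noncomputable section

open Complex MeasureTheory Filter Topology Set Metric
open scoped ComplexConjugate NNReal

namespace Summit.AnomalousDissipation.AnomalousDissipation.Theorems.BurgersLayerKH.Sheet.Resolvent

open Literature.Analysis.ODE

/-! ## Global solutions of `W'' = Q W` for continuous `Q : ℝ → ℂ` -/

/-- **Global existence** for `W'' = Q W` with continuous `Q : ℝ → ℂ` and prescribed data at `t₀`
(the first-order system has linear growth on bounded time intervals). [folklore] -/
theorem exists_isSol2_univ {Q : ℝ → ℂ} (hQ : Continuous Q) (t₀ : ℝ) (c₀ c₁ : ℂ) :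
    ∃ y y' : ℝ → ℂ, IsSol2 Q y y' univ ∧ y t₀ = c₀ ∧ y' t₀ = c₁ := by
  have hK : ∀ T : ℝ, ∃ K : ℝ≥0, ∀ t ∈ Icc (-T) T,
      LipschitzWith K (linField (fun _ : ℝ => (0 : ℂ)) Q t) ∧
        ∀ x, ‖linField (fun _ : ℝ => (0 : ℂ)) Q t x‖ ≤ K * ‖x‖ := by
    intro T
    obtain ⟨B, hB⟩ := isCompact_Icc.exists_bound_of_continuousOn (hQ.continuousOn (s := Icc (-T) T))
    have hle : ∀ t ∈ Icc (-T) T, 1 + ‖(fun _ : ℝ => (0 : ℂ)) t‖ + ‖Q t‖ ≤ 1 + max B 0 := by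
      intro t ht
      simp only [norm_zero, add_zero]
      linarith [hB t ht, le_max_left B 0]
    refine ⟨⟨1 + max B 0, by positivity⟩, fun t ht => ⟨?_, fun x => ?_⟩⟩
    · exact (lipschitzWith_linField _ Q t).weaken (hle t ht)
    · exact (norm_linField_le _ Q t x).trans (mul_le_mul_of_nonneg_right (hle t ht) (norm_nonneg _))
  have hcont : ∀ x, Continuous (fun t => linField (fun _ : ℝ => (0 : ℂ)) Q t x) := by
    intro x
    simp only [linField]
    fun_prop
  obtain ⟨Y, hY0, hY⟩ := exists_solution_of_linearGrowth_at hK hcont t₀ (c₀, c₁)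
  refine ⟨fun t => (Y t).1, fun t => (Y t).2, ⟨fun t _ => ?_, fun t _ => ?_⟩, by simp [hY0],
    by simp [hY0]⟩
  · have h1 := (ContinuousLinearMap.fst ℝ ℂ ℂ).hasFDerivAt.comp_hasDerivAt t (hY t)
    simpa [linField, Function.comp_def] using h1
  · have h2 := (ContinuousLinearMap.snd ℝ ℂ ℂ).hasFDerivAt.comp_hasDerivAt t (hY t)
    simpa [linField, Function.comp_def] using h2

/-- **Global uniqueness**: two global solutions with the same data at `t₀` coincide, with their
derivatives. [folklore] -/
theorem eq_of_isSol2_univ {Q : ℝ → ℂ} (hQ : Continuous Q) {y y' z z' : ℝ → ℂ}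
    (hy : IsSol2 Q y y' univ) (hz : IsSol2 Q z z' univ) {t₀ : ℝ} (h0 : y t₀ = z t₀)
    (h1 : y' t₀ = z' t₀) (t : ℝ) : y t = z t ∧ y' t = z' t := by
  have h := (hy.mono (subset_univ (Ioi (min t t₀ - 1)))).eqOn_Ioi hQ.continuousOn
    (hz.mono (subset_univ _)) (show min t t₀ - 1 < t₀ by
      linarith [min_le_right t t₀]) h0 h1
  have ht : t ∈ Ioi (min t t₀ - 1) := show min t t₀ - 1 < t by linarith [min_le_left t t₀]
  exact ⟨h.1 ht, h.2 ht⟩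

/-- The Wronskian of two global solutions is constant on `ℝ`. [folklore] -/
theorem wronskian_eq_univ {Q : ℝ → ℂ} {y y' z z' : ℝ → ℂ} (hy : IsSol2 Q y y' univ)
    (hz : IsSol2 Q z z' univ) (s t : ℝ) : wronskian y y' z z' s = wronskian y y' z z' t :=
  (hy.mono (subset_univ (Ioi (min s t - 1)))).wronskian_eq (hz.mono (subset_univ _))
    (by linarith [min_le_left s t]) (by linarith [min_le_right s t])

/-! ## Recessive global solutions -/

/-- **A global solution recessive at `+∞`**: for continuous `Q` with `re Q ≥ γ²` on `ℝ` there is a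
global solution with data of norm `1` at `0` and dichotomy energy `E_γ ≤ 0` EVERYWHERE (recessive on
`[0, ∞)` by `exists_recessive`, extended to `ℝ` by global existence and uniqueness; `E_γ ≤ 0`
propagates to the left by `solEnergy_nonpos_of_le`). [folklore] -/
theorem exists_recessive_univ {Q : ℝ → ℂ} {γ : ℝ} (hQ : Continuous Q)
    (hγ : ∀ t, γ ^ 2 ≤ (Q t).re) :
    ∃ y y' : ℝ → ℂ, IsSol2 Q y y' univ ∧ ‖(y 0, y' 0)‖ = 1 ∧ ∀ t, solEnergy γ y y' t ≤ 0 := by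
  have hγ' : ∀ t : ℝ, (0 : ℝ) ≤ t → γ ^ 2 ≤ RCLike.re (Q t) := fun t _ => by
    simpa using hγ t
  obtain ⟨z, z', hz, hz1, hE⟩ := IsSol2.exists_recessive (𝕜 := ℂ) (r₀ := -1) (r₁ := 0) (γ := γ)
    hQ.continuousOn (by norm_num) hγ'
  obtain ⟨y, y', hy, hy0, hy1⟩ := exists_isSol2_univ hQ 0 (z 0) (z' 0)
  have heq := (hy.mono (subset_univ _)).eqOn_Ioi hQ.continuousOn hz (by norm_num : (-1 : ℝ) < 0)
    hy0 hy1
  have hE' : ∀ s, 0 ≤ s → solEnergy γ y y' s ≤ 0 := fun s hs => by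
    have h1 : y s = z s := heq.1 (show (-1 : ℝ) < s by linarith)
    have h2 : y' s = z' s := heq.2 (show (-1 : ℝ) < s by linarith)
    simp only [solEnergy, h1, h2]
    exact hE s hs
  refine ⟨y, y', hy, by rw [hy0, hy1]; exact hz1, fun t => ?_⟩
  rcases le_or_gt 0 t with ht | ht
  · exact hE' t ht
  · exact (hy.mono (subset_univ (Ioi (t - 1)))).solEnergy_nonpos_of_le (r₁ := t) (by linarith)
      (fun s _ => by simpa using hγ s) le_rfl ht.le (hE' 0 le_rfl)

/-- **Decay of a globally recessive solution**: `E_γ ≤ 0` on `ℝ` gives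
`‖y t‖ ≤ e^{−(√2γ/2)(t − s)} ‖y s‖` for all `s ≤ t`. [folklore] -/
theorem norm_le_of_solEnergy_nonpos {Q : ℝ → ℂ} {y y' : ℝ → ℂ} {γ : ℝ} (hy : IsSol2 Q y y' univ)
    (hE : ∀ t, solEnergy γ y y' t ≤ 0) {s t : ℝ} (hst : s ≤ t) :
    ‖y t‖ ≤ Real.exp (-(Real.sqrt 2 * γ / 2) * (t - s)) * ‖y s‖ := by
  have h := (hy.mono (subset_univ (Ioi (s - 1)))).normSq_le_of_solEnergy_nonpos (r₁ := s)
    (by linarith) (fun τ _ => hE τ) le_rfl hst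
  have he : Real.exp (-(Real.sqrt 2 * γ) * (t - s)) =
      Real.exp (-(Real.sqrt 2 * γ / 2) * (t - s)) ^ 2 := by
    rw [← Real.exp_nat_mul]
    congr 1
    push_cast
    ring
  rw [he, ← mul_pow] at h
  have h2 := (pow_le_pow_iff_left₀ (norm_nonneg _) (by positivity) two_ne_zero).1 h
  linarith [h2, mul_comm (‖y s‖) (Real.exp (-(Real.sqrt 2 * γ / 2) * (t - s)))]

/-- The energy condition `E_γ ≤ 0` in pointwise form: `2 re(ȳ y') ≤ −√2 γ ‖y‖²`. [folklore] -/
theorem two_re_le_of_solEnergy_nonpos {y y' : ℝ → ℂ} {γ : ℝ} {t : ℝ}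
    (hE : solEnergy γ y y' t ≤ 0) :
    2 * (conj (y t) * y' t).re ≤ -(Real.sqrt 2 * γ) * ‖y t‖ ^ 2 := by
  have h : 2 * RCLike.re (conj (y t) * y' t) + Real.sqrt 2 * γ * ‖y t‖ ^ 2 ≤ 0 := hE
  rw [RCLike.re_to_complex] at h
  linarith

/-- **The key product bound.** If at a point `2 re(ā a') ≤ −√2γ‖a‖²`, `2 re(b̄ b') ≥ √2γ‖b‖²`
(`γ > 0`) and `a b' − a' b = w`, then `‖a‖ ‖b‖ ≤ ‖w‖/(√2 γ)`: indeed
`re(ā b̄ w) = ‖a‖² re(b̄ b') − ‖b‖² re(ā a') ≥ √2 γ ‖a‖² ‖b‖²` while `re(ā b̄ w) ≤ ‖a‖ ‖b‖ ‖w‖`.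
[folklore] -/
theorem norm_mul_norm_le_of_energies {a a' b b' w : ℂ} {γ : ℝ} (hγ : 0 < γ)
    (ha : 2 * (conj a * a').re ≤ -(Real.sqrt 2 * γ) * ‖a‖ ^ 2)
    (hb : Real.sqrt 2 * γ * ‖b‖ ^ 2 ≤ 2 * (conj b * b').re) (hw : a * b' - a' * b = w) :
    ‖a‖ * ‖b‖ ≤ ‖w‖ / (Real.sqrt 2 * γ) := by
  have hκ : 0 < Real.sqrt 2 * γ := by positivity
  have key : conj a * conj b * w = (‖a‖ ^ 2 : ℝ) * (conj b * b') - (‖b‖ ^ 2 : ℝ) * (conj a * a') := by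
    rw [← hw]
    push_cast
    rw [← Complex.conj_mul' a, ← Complex.conj_mul' b]
    ring
  have hre : (conj a * conj b * w).re = ‖a‖ ^ 2 * (conj b * b').re - ‖b‖ ^ 2 * (conj a * a').re := by
    rw [key, Complex.sub_re, Complex.re_ofReal_mul, Complex.re_ofReal_mul]
  have hlow : Real.sqrt 2 * γ * (‖a‖ ^ 2 * ‖b‖ ^ 2) ≤ (conj a * conj b * w).re := by
    rw [hre]
    nlinarith [mul_le_mul_of_nonneg_left hb (sq_nonneg ‖a‖),
      mul_le_mul_of_nonneg_left ha (sq_nonneg ‖b‖)]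
  have hup : (conj a * conj b * w).re ≤ ‖a‖ * ‖b‖ * ‖w‖ := by
    refine (Complex.re_le_norm _).trans ?_
    rw [norm_mul, norm_mul, Complex.norm_conj, Complex.norm_conj]
  have hab : 0 ≤ ‖a‖ * ‖b‖ := by positivity
  rw [le_div_iff₀ hκ]
  rcases hab.eq_or_lt with h0 | hpos
  · rw [← h0]; simp
  · have : Real.sqrt 2 * γ * (‖a‖ * ‖b‖) * (‖a‖ * ‖b‖) ≤ ‖w‖ * (‖a‖ * ‖b‖) := by nlinarith
    nlinarith [le_of_mul_le_mul_right this hpos]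

/-- **Whole-line exponential dichotomy for `W'' = Q W`, `re Q ≥ γ² > 0`** (registered sub-goal of
`stub_resolventExists`): global solutions `W₊` (recessive at `+∞`) and `W₋` (recessive at `−∞`) with
Wronskian `≡ 1`, two-sided exponential decay at rate `√2γ/2`, and the product bound
`‖W₊ t‖ ‖W₋ t‖ ≤ 1/(√2γ)`. [folklore] -/
theorem resolvent_dichotomy : ∀ (Q : ℝ → ℂ) (γ : ℝ), Continuous Q → 0 < γ → (∀ t : ℝ, γ ^ 2 ≤ (Q t).re) → ∃ Wp Wp' Wm Wm' : ℝ → ℂ, Literature.Analysis.ODE.IsSol2 Q Wp Wp' Set.univ ∧ Literature.Analysis.ODE.IsSol2 Q Wm Wm' Set.univ ∧ (∀ t : ℝ, Literature.Analysis.ODE.wronskian Wp Wp' Wm Wm' t = 1) ∧ (∀ s t : ℝ, s ≤ t → ‖Wp t‖ ≤ Real.exp (-(Real.sqrt 2 * γ / 2) * (t - s)) * ‖Wp s‖) ∧ (∀ s t : ℝ, s ≤ t → ‖Wm s‖ ≤ Real.exp (-(Real.sqrt 2 * γ / 2) * (t - s)) * ‖Wm t‖) ∧ ∀ t : ℝ,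 ‖Wp t‖ * ‖Wm t‖ ≤ 1 / (Real.sqrt 2 * γ) := by
  intro Q γ hQ hγ hre
  -- `W₊`: recessive at `+∞`
  obtain ⟨Wp, Wp', hp, hp1, hEp⟩ := exists_recessive_univ hQ hre
  -- `V`: recessive at `−∞`, by reflection
  have hQn : Continuous fun t : ℝ => Q (-t) := hQ.comp continuous_neg
  obtain ⟨z, z', hz, hz1, hEz⟩ := exists_recessive_univ (Q := fun t => Q (-t)) hQn (fun t => hre (-t))
  set V : ℝ → ℂ := fun t => z (-t) with hV
  set V' : ℝ → ℂ := fun t => -z' (-t) with hV'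
  have hv : IsSol2 Q V V' univ := by
    have h := hz.comp_neg
    simp only [neg_neg, Set.neg_univ] at h
    exact h
  -- pointwise energies
  have eP : ∀ t, 2 * (conj (Wp t) * Wp' t).re ≤ -(Real.sqrt 2 * γ) * ‖Wp t‖ ^ 2 := fun t =>
    two_re_le_of_solEnergy_nonpos (hEp t)
  have eV : ∀ t, Real.sqrt 2 * γ * ‖V t‖ ^ 2 ≤ 2 * (conj (V t) * V' t).re := fun t => by
    have h := two_re_le_of_solEnergy_nonpos (hEz (-t))
    simp only [hV, hV', mul_neg, Complex.neg_re]
    linarith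
  -- the Wronskian is a non-zero constant
  set w : ℂ := wronskian Wp Wp' V V' 0 with hw
  have hwt : ∀ t, wronskian Wp Wp' V V' t = w := fun t => wronskian_eq_univ hp hv t 0
  have hw0 : w ≠ 0 := by
    intro hw0
    have hne : Wp 0 ≠ 0 ∨ Wp' 0 ≠ 0 := by
      by_contra h
      push Not at h
      rw [h.1, h.2] at hp1
      simp at hp1
    obtain ⟨c, hc, hc'⟩ := (hp.mono (subset_univ (Ioi (-1)))).exists_eq_smul_of_wronskian_eq_zero
      hQ.continuousOn (hv.mono (subset_univ _)) (by norm_num : (-1 : ℝ) < 0) hw0 hne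
    -- `V` vanishes on `(-1, ∞)`
    have hV0 : ∀ t, (-1 : ℝ) < t → V t = 0 := by
      intro t ht
      have h1 := eP t
      have h2 := eV t
      rw [hc ht, hc' ht] at h2
      have e : (conj (c * Wp t) * (c * Wp' t)).re = ‖c‖ ^ 2 * (conj (Wp t) * Wp' t).re := by
        rw [map_mul, show conj c * conj (Wp t) * (c * Wp' t) = (conj c * c) * (conj (Wp t) * Wp' t) by
          ring, Complex.conj_mul', ← Complex.ofReal_pow, Complex.re_ofReal_mul]
      rw [e, norm_mul] at h2
      have h3 : Real.sqrt 2 * γ * (‖c‖ ^ 2 * ‖Wp t‖ ^ 2) ≤ 0 := by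
        nlinarith [mul_le_mul_of_nonneg_left h1 (sq_nonneg ‖c‖)]
      have h4 : ‖c‖ ^ 2 * ‖Wp t‖ ^ 2 ≤ 0 :=
        nonpos_of_mul_nonpos_right (by nlinarith [h3]) (by positivity : 0 < Real.sqrt 2 * γ)
      have h5 : ‖c * Wp t‖ = 0 := by
        rw [norm_mul]; nlinarith [norm_nonneg c, norm_nonneg (Wp t), h4, sq_nonneg (‖c‖ * ‖Wp t‖)]
      rw [hc ht]
      exact norm_eq_zero.1 h5
    -- hence its derivative vanishes at `0`, contradicting the normalisation of the data of `z`
    have hV'0 : V' 0 = 0 := by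
      have hd : HasDerivAt V (V' 0) 0 := hv.hasDerivAt 0 (mem_univ _)
      have hd0 : HasDerivAt V 0 0 := by
        refine (hasDerivAt_const (0 : ℝ) (0 : ℂ)).congr_of_eventuallyEq ?_
        filter_upwards [Ioi_mem_nhds (show (-1 : ℝ) < 0 by norm_num)] with t ht using hV0 t ht
      exact hd.unique hd0
    have h1 : z 0 = 0 := by simpa [hV] using hV0 0 (by norm_num)
    have h2 : z' 0 = 0 := by simpa [hV'] using hV'0
    rw [h1, h2] at hz1
    simp at hz1
  -- normalise: `W₋ := w⁻¹ V`
  refine ⟨Wp, Wp', fun t => w⁻¹ * V t, fun t => w⁻¹ * V' t, hp, hv.smul _, fun t => ?_,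
    fun s t hst => norm_le_of_solEnergy_nonpos hp hEp hst, fun s t hst => ?_, fun t => ?_⟩
  · have h := hwt t
    unfold wronskian at h ⊢
    field_simp
    linear_combination h
  · have h := norm_le_of_solEnergy_nonpos hz hEz (neg_le_neg hst)
    rw [norm_mul, norm_mul, show -(Real.sqrt 2 * γ / 2) * (-s - -t) = -(Real.sqrt 2 * γ / 2) * (t - s) by
      ring] at *
    have := mul_le_mul_of_nonneg_left h (norm_nonneg w⁻¹)
    simp only [hV]
    linarith
  · have hb : Real.sqrt 2 * γ * ‖w⁻¹ * V t‖ ^ 2 ≤ 2 * (conj (w⁻¹ * V t) * (w⁻¹ * V' t)).re := by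
      have e : (conj (w⁻¹ * V t) * (w⁻¹ * V' t)).re = ‖w⁻¹‖ ^ 2 * (conj (V t) * V' t).re := by
        rw [map_mul, show conj w⁻¹ * conj (V t) * (w⁻¹ * V' t) = (conj w⁻¹ * w⁻¹) * (conj (V t) * V' t)
          by ring, Complex.conj_mul', ← Complex.ofReal_pow, Complex.re_ofReal_mul]
      rw [e, norm_mul]
      nlinarith [mul_le_mul_of_nonneg_left (eV t) (sq_nonneg ‖w⁻¹‖)]
    have hwr : Wp t * (w⁻¹ * V' t) - Wp' t * (w⁻¹ * V t) = 1 := by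
      have h := hwt t
      unfold wronskian at h
      field_simp
      linear_combination h
    have h := norm_mul_norm_le_of_energies hγ (eP t) hb hwr
    simpa using h

end Summit.AnomalousDissipation.AnomalousDissipation.Theorems.BurgersLayerKH.Sheet.Resolvent

end
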